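import Summits.AtomisticToContinuum.HydrodynamicLimit.Theorems.AntiMazurCoboundariesCorrectorPressureDecayKiferCanonicalLocalLimit
import Summits.AtomisticToContinuum.HydrodynamicLimit.Theorems.AntiMazurCoboundariesCorrectorPressureDecayTangentTightnessLaplace
import Literature.MathematicalPhysics.KineticTheory.HardSphereGibbsGNZSandwich
import Mathlib.InformationTheory.KullbackLeibler.Basic
import Mathlib.Probability.ConditionalProbability

/-! Scratch: signatures of the c9 wave-2 stubs (elaboration check only) + the three shared cell definitions. -/

noncomputable section

open MeasureTheory ProbabilityTheory Set Filter Topology InformationTheory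
open scoped ENNReal NNReal

namespace Summit.AtomisticToContinuum.HydrodynamicLimit.Theorems.KiferCompactification

open Literature.MathematicalPhysics.KineticTheory (T3 V3 hsDiameter localGibbsLaw blowUpPoint blowUp)
open Literature.MathematicalPhysics.KineticTheory.HardSphereDLR (gibbsSpecMeasure)
open Literature.MathematicalPhysics.KineticTheory.PointProcess (windowLaw windowRestrict centredBox laplaceFunctional)
open Literature.Analysis.FluidPDE (HardSphereFlow Config IsHardCore IsHardSphereGibbs IsTranslationInvariant hardSphereDomain)
open Literature.Analysis.FunctionSpaces (PointConfig)
open Literature.Analysis.FunctionSpaces.Torus (proj)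

/-! ## Shared definitions (cells of the blown-up torus cube) -/

/-- The CELL with multi-index `j` of the cube `(-S/2, S/2]³` cut into `m³` congruent half-open boxes of side `S/m`:
`{y | ∀ i, y i ∈ (-S/2 + jᵢ S/m, -S/2 + (jᵢ+1) S/m]}` (the blown-up torus at scale `ε = S⁻¹` is the cube `(-S/2, S/2]³`,
`Torus.reprSym` takes values in `(-1/2, 1/2]³`). -/
def c9Cell (S : ℝ) (m : ℕ) (j : Fin 3 → Fin m) : Set V3 :=
  {y | ∀ i, y i ∈ Ioc (-S / 2 + ((j i : ℕ) : ℝ) * (S / m)) (-S / 2 + (((j i : ℕ) : ℝ) + 1) * (S / m))}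

/-- The lower CORNER of the cell `j` relative to the cell `0`: the vector `(jᵢ S/m)ᵢ`, so that `c9Cell S m j = corner + c9Cell S m 0`. -/
def c9CellCorner (S : ℝ) (m : ℕ) (j : Fin 3 → Fin m) : V3 :=
  WithLp.toLp 2 fun i => ((j i : ℕ) : ℝ) * (S / m)

/-- The squared PERIODIC distance of two positions of the cube of side `S` (period `S` in each coordinate; for coordinates
differing by less than `S` the periodic coordinate distance is `min |d| (S - |d|)`): the blow-up by `S` of the torus distance
`‖Torus.reprSym (q - q')‖` of the pre-images. -/
def c9PerSqDist (S : ℝ) (y y' : V3) : ℝ :=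
  ∑ i, (min |y i - y' i| (S - |y i - y' i|)) ^ 2

/-- The event, on TUPLES of cell configurations indexed by the `m³` cells, that the superposed configuration is a blown-up
TORUS hard-sphere configuration of exactly `n` unit spheres: total number of points `n`, and any two distinct points (in the
same or in different cells) at periodic distance `≥ 1`. -/
def c9TorusHardCoreTuples (S : ℝ) (m n : ℕ) : Set ((Fin 3 → Fin m) → PointConfig (V3 × V3)) :=
  {t | (∑ j, (t j).count univ) = n ∧
    ∀ j j' (p q : V3 × V3), p ∈ t j → q ∈ t j' → (j ≠ j' ∨ p ≠ q) → 1 ≤ c9PerSqDist S p.1 q.1}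

/-! ## Wave-2 stub signatures -/

/-- W2-1: window lower semicontinuity along unit-weight tangent states, FIXED reference. -/
theorem c9_klDiv_windowLaw_tangent_le_liminf {σ : ℝ} (hσ : 0 < σ) {N : ℕ → ℕ}
    {Q : ∀ k, Measure (Config (N k + 1) (Fin 3) T3)} [∀ k, IsProbabilityMeasure (Q k)]
    (hQ : ∀ k, ∀ᵐ z ∂(Q k), z ∈ hardSphereDomain (Literature.Analysis.FluidPDE.Torus.geometry (Fin 3)) (N k + 1)
      (hsDiameter σ (N k)))
    {ι : ℕ → ℕ} {μ : Measure (PointConfig (V3 × V3))} [IsProbabilityMeasure μ]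
    (hμ : IsTangentState σ (fun _ => (1 : ℝ)) N Q ι μ) {U : Set V3} (hU : IsOpen U) (hUb : Bornology.IsBounded U)
    (ρ : Measure (PointConfig (V3 × V3))) [IsProbabilityMeasure ρ] :
    klDiv (windowLaw U μ) ρ ≤
      liminf (fun k => klDiv (windowLaw U (blowUpLaw σ (fun _ => (1 : ℝ)) (N (ι k)) (Q (ι k)))) ρ) atTop := by
  sorry

/-- W2-2: the cell-tuple law of the blown-up canonical torus law is the product of the free cell measures conditioned on the
torus hard core and the particle number. -/
theorem c9_map_cellTuple_canonicalBlowUp_eq_cond (σ a θ : ℝ) (u₀ : V3) (hσ : 0 < σ) (hσ2 : σ ≤ 1 / 2) (ha : 0 < a)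
    (hθ : 0 < θ) {z : ℝ} (hz : 0 < z) (N : ℕ)
    (Φ : HardSphereFlow (Literature.Analysis.FluidPDE.Torus.geometry (Fin 3)) (hsDiameter σ N) (N + 1)) (x₀ : T3)
    {m : ℕ} (hm : 0 < m) :
    ((localGibbsLaw σ (fun _ => a) (fun _ => u₀) (fun _ => θ) N Φ).map (blowUp (hsDiameter σ N) x₀)).map
        (fun ω (j : Fin 3 → Fin m) => windowRestrict (c9Cell (hsDiameter σ N)⁻¹ m j) ω) =
      (Measure.pi fun j : Fin 3 → Fin m => gibbsSpecMeasure 1 z θ⁻¹ u₀ (c9Cell (hsDiameter σ N)⁻¹ m j) ∅)[|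
        c9TorusHardCoreTuples (hsDiameter σ N)⁻¹ m (N + 1)] := by
  sorry

/-- W2-3: additivity of the relative entropy along a conditioning. -/
theorem c9_klDiv_eq_klDiv_cond_add_klDiv_cond {Ω : Type*} [MeasurableSpace Ω] (P μ : Measure Ω) [IsProbabilityMeasure P]
    [IsProbabilityMeasure μ] {E : Set Ω} (hE : MeasurableSet E) (hPE : P ≪ μ[|E]) :
    klDiv P μ = klDiv P (μ[|E]) + klDiv (μ[|E]) μ := by
  sorry

/-- W2-4: convexity of the relative entropy in the first argument over a base point, FIXED reference. -/
theorem c9_klDiv_map_prod_le_lintegral_const {T Z Ω : Type*} [MeasurableSpace T] [MeasurableSpace Z] [MeasurableSpace Ω]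
    (m : Measure T) [IsProbabilityMeasure m] (Q : Measure Z) [IsProbabilityMeasure Q] (ρ : Measure Ω)
    [IsProbabilityMeasure ρ] {F : T × Z → Ω} (hF : Measurable F) :
    klDiv ((m.prod Q).map F) ρ ≤ ∫⁻ x, klDiv (Q.map fun y => F (x, y)) ρ ∂m := by
  sorry

/-- W2-5a: the configuration seam lemma for cells: the blow-up seen in cell `j` is the translate by the cell corner of the
blow-up around the shifted base point seen in cell `0`. -/
theorem c9_windowRestrict_cell_blowUp_eq_translate {ε : ℝ} (hε : 0 < ε) {m : ℕ} (hm : 0 < m) (j : Fin 3 → Fin m) (x₀ : T3)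
    {n : ℕ} (z : Config n (Fin 3) T3) :
    windowRestrict (c9Cell ε⁻¹ m j) (blowUp ε x₀ z) =
      (windowRestrict (c9Cell ε⁻¹ m fun _ => ⟨0, hm⟩) (blowUp ε (x₀ + proj (ε • c9CellCorner ε⁻¹ m j)) z)).translate
        (c9CellCorner ε⁻¹ m j, 0) := by
  sorry

/-- W2-5b: translation covariance of the free finite-volume measure. -/
theorem c9_gibbsSpecMeasure_empty_translate (z β : ℝ) (u : V3) {Λ : Set V3} (hΛ : MeasurableSet Λ) (c : V3) :
    gibbsSpecMeasure 1 z β u ((c + ·) '' Λ) ∅ = (gibbsSpecMeasure 1 z β u Λ ∅).map (PointConfig.translate (c, (0 : V3))) := by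
  sorry

end Summit.AtomisticToContinuum.HydrodynamicLimit.Theorems.KiferCompactification

end
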